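import Literature.MathematicalPhysics.QuantumFieldTheory.BalabanImbrieJaffe1984to88.BIJ88OpDecay230Proof
import Literature.MathematicalPhysics.QuantumFieldTheory.BalabanImbrieJaffe1984to88.BIJ85Sect7Statements

/-!
# `BalabanImbrieJaffe1984to88.BIJ88MultiscaleDecay223` — T. Bałaban, J. Imbrie, A. Jaffe, *Effective action and cluster properties of
the abelian Higgs model*, Commun. Math. Phys. **114** (1988) 257–315 [BalabanImbrieJaffe1988]: the MULTISCALE RESUMMATION of pp. 261–262
behind **(2.23)**, **(2.16)** and **(2.13)** — a sum over the scales `j = 0, …, k−1` of kernels, each decaying exponentially «on its own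
length scale» `L^jη` and carrying a scaling factor `(L^jη)^{−m}`, is bounded UNIFORMLY IN k away from the diagonal («the rapid decay of
terms with small j controls the scalings and the sum over j»), is «not well controlled for close points» when the factors grow, and is
bounded everywhere when they do not — PROVED, with the constants explicit; the per-scale kernel estimates of [I] = [BalabanImbrieJaffe1985]
((I.7.2.2)–(I.7.2.4)) enter as the displayed hypotheses, (I.7.2.4) through r15's `BIJ85Sect7Statements.KernelData.Ineq724`

statement-level skeleton of published theorems with citation tags; proofs where landed; nothing here is a claim about the Yang–Mills mass gap

PDF held: `paper:balaban1988-cmp114-bij-abelian-higgs-effective-action` (journal page = PDF page + 256); pp. 261–262 [PDF 5–6] read this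
session from the text layer (`lit read … --pages 4-7`).

WHAT IS REPRODUCED.  SKELETON rows **C2.Eq2.23** (primary), **C2.Eq2.13** (with the unnumbered finite-range display after it) and the
bracketed mechanism sentence of **C2.Eq2.16** (cell `lit-balaban`, HOME `run/shared/lean/pub/lit-balaban/`; Phase-2 seat p08 gen 4 = unit
`lit-balaban-p08`, own-lane successor of the seat's row C1.Eq7.2.4 = [I] (7.2.4) (`BIJ85Ineq724Proof`, p248563/p248785); C2 §§1–4 fold owner
r18, referee ref-5; TAKING line HOME/STATUS.md 2026-08-21T04:59:02Z).  Before this file the three rows were the bare `def … : Prop` shapes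
`BIJ88Sect2Statements.DecayFar` / `OpDecay` / `Vanishes` (typed p239939; the inheritance «C_{k,loc} also satisfies (2.23)» is p02's
`BIJ88Close218Proof.decayFar_loc`).
p. 261 [PDF 5], verbatim: *"From C^{(k)}_{loc} and H_{k,loc} we construct a localized η-lattice gauge field propagator analogous to 𝒟_k:
𝒟_{k,loc} = Σ_{j=0}^{k−1} H^{L^jη}_{j,loc}C^{(j),L^jη}_{loc}H^{*L^j}_{j,loc} ≡ Σ_{j=0}^{k−1} G^{(j),η}_{loc}. (2.12) Superscripts L^jη, η, etc.
indicate the lattice spacing for operators rescaled to nonstandard lattices. This propagator derives its regularity and decay from that of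
C^{(j)}_{loc} and H_{k,loc}. Thus |(𝒟_{k,loc}f)(b)| ≦ ce^{−c dist(suppt f,b)}‖f‖_∞, (2.13) and similarly for derivatives of 𝒟_{k,loc} and Hölder
derivatives of order less than 2. Furthermore, 𝒟_{k,loc}(b₁,b₂) = 0 for dist(b₁,b₂) ≧ ½r(e_k) … Writing 𝒟_k in hierarchical form as in
(2.12) and using the regularity of H_j, 0 ≦ j < k, we see that |σ_k(p₁,p₂)| ≦ ce^{−c dist(p₁,p₂)} for dist(p₁,p₂) ≧ c. (2.16) [The rapid decay
of the terms with small j compensates for the scaling factors (L^jη)^{−1}.] For close p₁, p₂ the kernel of σ_k can be large, of the order of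
η^{−2}."*  p. 262 [PDF 6], verbatim: *"By changing gauge in each term in the hierarchical sum defining 𝒟_k and applying (I.5.3.1), we obtain
C_k = D_k + Σ_{j=0}^{k−1} D^{L^jη}_jC^{(j),L^jη}H^{*L^jη}_j∂*Q^{e*}_k∂. (2.22) The kernels of all these operators have an exponential decay on
their respective length scales; for D_k the required estimate is (I.7.2.4). The sum over j is not well controlled for close points; this will
not be important for us. For more distant points, however, the rapid decay of terms with small j controls the scalings and the sum over j to
yield a uniform bound |C_k(x,b′)| ≦ ce^{−c dist(x,b′)}, dist(x,b′) > c. (2.23) Here x ∈ T_{0,η}, b′ ∈ T^{(k)*}_{0,1}. Of course there is no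
uniform bound on ∂C_k."*  (Both pages also read as images rendered from the held PDF, seat folder `renders/bij88-p005.png`, `-p006.png`.)

WHAT IS PROVED HERE (0 `sorry`, standard axioms; theorems only, kind «hence-step», r18's abstract real kernels).  A term `n = k − j` scales
below the top one is a kernel bounded by `A·Λⁿ·e^{−δLⁿ·dist}` in the step-k distance: rate `δLⁿ` = decay «on its own length scale» `L^jη = L^{−n}`,
prefactor `Λⁿ` = the «scaling factor» (`Λ = L` for print's `(L^jη)^{−1}`).
§1 MULTISCALE RESUMMATION: `scaleTerm_le` (`Λⁿe^{−δLⁿd} ≤ (Λe^{−δ(L−1)d₀})ⁿe^{−δd}` for `d ≥ d₀`, Bernoulli); **`multiscale_sum_le`** (ratio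
`Λe^{−δ(L−1)d₀} ≤ q < 1` ⟹ `Σ_{n<N}Λⁿe^{−δLⁿd} ≤ e^{−δd}/(1−q)` for EVERY N, d ≥ d₀); `half_of_threshold` (`d₀ ≥ (log Λ + log 2)/(δ(L−1))` ⟹
q = ½: «dist(x,b′) > c»); `multiscale_sum_le_of_lt_one` (`Λ < 1`: all `d ≥ 0`, the regime of (2.13)); `le_multiscale_sum_at_zero` (`Λ ≥ 1`:
the sum at d = 0 is ≥ N — «not well controlled for close points»).
§2 COMPOSITION ACROSS CARRIERS: `abs_sum_mul_le_comp` (`|K| ≤ Ae^{−δρ₁}`, `|M| ≤ Be^{−δρ₂}`, triangle inequality, row sum S ⟹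
`|Σ_bK(a,b)M(b,c)| ≤ ABS·e^{−(δ/2)ρ(a,c)}`), `abs_sum_mul_le_comp₃` (the printed shape `H_{j,loc}C^{(j)}_{loc}H*_{j,loc}`, rate δ/4),
`vanishes_comp`/`vanishes_comp₃`/`vanishes_sum` (finite ranges add under composition and are kept by sums; r18's `Vanishes`).
§3 **(2.23)**: `abs_multiscaleKernel_le` (per-scale bounds ⟹ `|Σ_{n<N}T_n(x,b′)| ≤ (A/(1−q))e^{−δdist}` for dist ≥ d₀, uniformly in N);
**`decayFar223_typed`** = r18's one-letter `DecayFar dist (Σ_{n<N}T_n) c` under `Λe^{−δ(L−1)c} ≤ ½`, `2A ≤ c ≤ δ` (cf. HOME/GAPS.md G-C2-p02-02);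
**`decayFar223_of_ineq724`** — the `n = 0` term is THE KERNEL `D_k` of [I] (7.2.4) on r15's `BIJ85Sect7Statements.KernelData` (hypothesis
`K.Ineq724 M δ`: «for D_k the required estimate is (I.7.2.4)»), the `j < k` terms of (2.22) the displayed per-scale hypotheses.
§4 **(2.16)**: `decayFar216_typed` — `σ_k = Dg + Σ_{n<N}T_n`, `Dg` of finite range (print: «of the order of η^{−2}» for close plaquettes,
`Q^e_kQ^{e*}_k = η^{−2}I` by [I] (2.24)), scaling factors `Lⁿ` ⟹ `DecayFar dist σ_k c`.
§5 **(2.13)**: `opDecay213` (`Λ < 1` ⟹ `|(𝒟_{k,loc}f)(b)| ≤ (A/(1−Λ))S·e^{−(δ/2)dist(suppt f,b)}‖f‖_∞` for ALL b, via p02's imported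
`BIJ88OpDecay230Proof.abs_applyK_le_of_kernel`), **`opDecay213_typed`** = r18's `OpDecay dist 𝒟_{k,loc} c` under `(A/(1−Λ))S ≤ c ≤ δ/2`;
`vanishes213_term` (`⅛r + ¼r + ⅛r = ½r(e_k)`) and **`vanishes213_typed`** = `Vanishes dist 𝒟_{k,loc} (r(e_k)/2)` from the per-term ranges.
HONEST SCOPE.  NOT derived here, displayed hypotheses instead: the per-scale kernel estimates ((I.7.2.2) `H_j`, (I.7.2.3) `C^{(j)}`, (I.7.2.4)
`D_j` = rows C1.Eq7.2.1-7.2.2/7.2.3/7.2.4 of [I]), the locality of `∂*Q^{e*}_k∂`, the scaling exponents of the «L^jη superscript» convention, the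
comparison `L^{j−k}r(e_j) ≤ r(e_k)` implicit in the ½r(e_k) range of the `j < k` terms, and the reading range(`C^{(k)}_{loc}`) = ¼r(e_k) ((2.8);
the sandwich (2.9) widens supports by O(1) blocks, absorbed in print's generic c).  «similarly for derivatives … Hölder derivatives» is not
typed (r18's row types the function bound only).  Nothing on d = 4 or the continuum; NOT summit progress.
-/

namespace Literature.MathematicalPhysics.QuantumFieldTheory.BalabanImbrieJaffe1984to88.BIJ88MultiscaleDecay223

open Finset BIJ88Sect2Statements BIJ88Close235Proof BIJ88OpDecay230Proof

noncomputable section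

variable {α β γ : Type*}

/-! ## §1  The multiscale resummation: «the rapid decay of terms with small j controls the scalings and the sum over j» -/

/-- Bernoulli: `n(L − 1) ≤ Lⁿ − 1` for `L ≥ 1` — the n-th scale is at least `n(L−1)` «lengths» longer than the top one.
[cite: BalabanImbrieJaffe1988, (2.23) p.262] -/
theorem mul_sub_one_le_pow_sub_one {L : ℝ} (hL : 1 ≤ L) (n : ℕ) : (n : ℝ) * (L - 1) ≤ L ^ n - 1 := by
  have h := one_add_mul_le_pow (show (-2 : ℝ) ≤ L - 1 by linarith) n
  have : (1 : ℝ) + (L - 1) = L := by ring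
  rw [this] at h
  linarith

/-- **One term, n scales down.**  For `L ≥ 1`, `Λ, δ ≥ 0`, `d ≥ d₀ ≥ 0`: `Λⁿ·e^{−δLⁿd} ≤ (Λ·e^{−δ(L−1)d₀})ⁿ · e^{−δd}` — the decay
on the finer scale `Lⁿd ≥ d + n(L−1)d₀` pays for the scaling factor `Λⁿ`. [cite: BalabanImbrieJaffe1988, (2.23) p.262] -/
theorem scaleTerm_le {L Λ δ d₀ d : ℝ} (hL : 1 ≤ L) (hΛ : 0 ≤ Λ) (hδ : 0 ≤ δ) (hd₀ : 0 ≤ d₀) (hd : d₀ ≤ d) (n : ℕ) :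
    Λ ^ n * Real.exp (-(δ * L ^ n) * d) ≤ (Λ * Real.exp (-(δ * (L - 1) * d₀))) ^ n * Real.exp (-δ * d) := by
  have hBern := mul_sub_one_le_pow_sub_one hL n
  have hLn : (1 : ℝ) ≤ L ^ n := one_le_pow₀ hL
  -- exponent comparison: −δLⁿd ≤ −n·δ(L−1)d₀ − δd
  have hexp : Real.exp (-(δ * L ^ n) * d) ≤ Real.exp (-(δ * (L - 1) * d₀)) ^ n * Real.exp (-δ * d) := by
    rw [← Real.exp_nat_mul, ← Real.exp_add]
    apply Real.exp_le_exp.2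
    have h1 : δ * ((L ^ n - 1) * d) ≥ δ * ((n : ℝ) * (L - 1) * d₀) := by
      apply mul_le_mul_of_nonneg_left _ hδ
      calc (n : ℝ) * (L - 1) * d₀ ≤ (L ^ n - 1) * d₀ := mul_le_mul_of_nonneg_right hBern hd₀
        _ ≤ (L ^ n - 1) * d := mul_le_mul_of_nonneg_left hd (by linarith)
    nlinarith
  calc Λ ^ n * Real.exp (-(δ * L ^ n) * d)
      ≤ Λ ^ n * (Real.exp (-(δ * (L - 1) * d₀)) ^ n * Real.exp (-δ * d)) :=
        mul_le_mul_of_nonneg_left hexp (pow_nonneg hΛ n)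
    _ = (Λ * Real.exp (-(δ * (L - 1) * d₀))) ^ n * Real.exp (-δ * d) := by rw [mul_pow]; ring

/-- **THE MULTISCALE RESUMMATION LEMMA (uniform in the number of scales).**  If `L ≥ 1`, `Λ, δ, d₀ ≥ 0` and the one-step ratio
`q ≥ Λe^{−δ(L−1)d₀}` is `< 1`, then for EVERY `N` and every `d ≥ d₀`: `Σ_{n<N} Λⁿe^{−δLⁿd} ≤ e^{−δd}/(1 − q)` — *"the rapid decay of terms
with small j controls the scalings and the sum over j to yield a uniform bound"*. [cite: BalabanImbrieJaffe1988, (2.23) p.262] -/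
theorem multiscale_sum_le {L Λ δ d₀ q : ℝ} (hL : 1 ≤ L) (hΛ : 0 ≤ Λ) (hδ : 0 ≤ δ) (hd₀ : 0 ≤ d₀)
    (hq : Λ * Real.exp (-(δ * (L - 1) * d₀)) ≤ q) (hq1 : q < 1) (N : ℕ) {d : ℝ} (hd : d₀ ≤ d) :
    ∑ n ∈ range N, Λ ^ n * Real.exp (-(δ * L ^ n) * d) ≤ Real.exp (-δ * d) / (1 - q) := by
  have hr0 : 0 ≤ Λ * Real.exp (-(δ * (L - 1) * d₀)) := mul_nonneg hΛ (Real.exp_pos _).le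
  have hq0 : 0 ≤ q := hr0.trans hq
  have hterm : ∀ n ∈ range N, Λ ^ n * Real.exp (-(δ * L ^ n) * d) ≤ q ^ n * Real.exp (-δ * d) := by
    intro n _
    calc Λ ^ n * Real.exp (-(δ * L ^ n) * d)
        ≤ (Λ * Real.exp (-(δ * (L - 1) * d₀))) ^ n * Real.exp (-δ * d) := scaleTerm_le hL hΛ hδ hd₀ hd n
      _ ≤ q ^ n * Real.exp (-δ * d) :=
          mul_le_mul_of_nonneg_right (pow_le_pow_left₀ hr0 hq n) (Real.exp_pos _).le
  have hgeom : ∑ n ∈ range N, q ^ n ≤ 1 / (1 - q) := by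
    have h := @geom_sum_Ico_le_of_lt_one ℝ _ _ _ q 0 N hq0 hq1
    rw [pow_zero] at h
    rwa [Finset.range_eq_Ico]
  calc ∑ n ∈ range N, Λ ^ n * Real.exp (-(δ * L ^ n) * d)
      ≤ ∑ n ∈ range N, q ^ n * Real.exp (-δ * d) := Finset.sum_le_sum hterm
    _ = (∑ n ∈ range N, q ^ n) * Real.exp (-δ * d) := by rw [Finset.sum_mul]
    _ ≤ (1 / (1 - q)) * Real.exp (-δ * d) := mul_le_mul_of_nonneg_right hgeom (Real.exp_pos _).le
    _ = Real.exp (-δ * d) / (1 - q) := by ring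

/-- **The threshold** («dist(x,b′) > c»): for `L > 1`, `δ > 0`, `Λ > 0`, any `d₀ ≥ (log Λ + log 2)/(δ(L−1))` makes the one-step ratio `≤ ½`.
[cite: BalabanImbrieJaffe1988, (2.23) p.262] -/
theorem half_of_threshold {L Λ δ d₀ : ℝ} (hL : 1 < L) (hδ : 0 < δ) (hΛ : 0 < Λ)
    (hd₀ : (Real.log Λ + Real.log 2) / (δ * (L - 1)) ≤ d₀) : Λ * Real.exp (-(δ * (L - 1) * d₀)) ≤ 1 / 2 := by
  have hpos : 0 < δ * (L - 1) := mul_pos hδ (by linarith)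
  have h1 : Real.log Λ + Real.log 2 ≤ δ * (L - 1) * d₀ := by
    have := (div_le_iff₀ hpos).1 hd₀
    linarith
  have h2 : Real.log (2 * Λ) ≤ δ * (L - 1) * d₀ := by
    rw [Real.log_mul (by norm_num) hΛ.ne']; linarith
  -- e^{−δ(L−1)d₀} ≤ e^{−log(2Λ)} = 1/(2Λ)
  have h3 : Real.exp (-(δ * (L - 1) * d₀)) ≤ (2 * Λ)⁻¹ := by
    have h := Real.exp_le_exp.2 (neg_le_neg h2)
    rwa [Real.exp_neg (Real.log (2 * Λ)), Real.exp_log (by positivity)] at h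
  calc Λ * Real.exp (-(δ * (L - 1) * d₀)) ≤ Λ * (2 * Λ)⁻¹ := mul_le_mul_of_nonneg_left h3 hΛ.le
    _ = 1 / 2 := by field_simp

/-- **The regime of the propagator sums (2.12)–(2.13): scaling factors `Λ < 1`.**  Then NO threshold is needed: for all `N` and all
`d ≥ 0`, `Σ_{n<N} Λⁿe^{−δLⁿd} ≤ e^{−δd}/(1 − Λ)`. [cite: BalabanImbrieJaffe1988, (2.13) p.261] -/
theorem multiscale_sum_le_of_lt_one {L Λ δ : ℝ} (hL : 1 ≤ L) (hΛ : 0 ≤ Λ) (hΛ1 : Λ < 1) (hδ : 0 ≤ δ) (N : ℕ) {d : ℝ}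
    (hd : 0 ≤ d) : ∑ n ∈ range N, Λ ^ n * Real.exp (-(δ * L ^ n) * d) ≤ Real.exp (-δ * d) / (1 - Λ) := by
  refine multiscale_sum_le hL hΛ hδ le_rfl ?_ hΛ1 N hd
  simp

/-- **«The sum over j is not well controlled for close points»**: with growing scaling factors `Λ ≥ 1`, at `d = 0` the N-scale sum is
`≥ N` — no bound uniform in the number of scales exists on the diagonal. [cite: BalabanImbrieJaffe1988, (2.23) p.262] -/
theorem le_multiscale_sum_at_zero {L Λ δ : ℝ} (hΛ : 1 ≤ Λ) (N : ℕ) :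
    (N : ℝ) ≤ ∑ n ∈ range N, Λ ^ n * Real.exp (-(δ * L ^ n) * 0) := by
  have hterm : ∀ n ∈ range N, (1 : ℝ) ≤ Λ ^ n * Real.exp (-(δ * L ^ n) * 0) := by
    intro n _
    rw [mul_zero, Real.exp_zero, mul_one]
    exact one_le_pow₀ hΛ
  calc (N : ℝ) = ∑ _n ∈ range N, (1 : ℝ) := by simp
    _ ≤ ∑ n ∈ range N, Λ ^ n * Real.exp (-(δ * L ^ n) * 0) := Finset.sum_le_sum hterm

/-! ## §2  Composition across carriers: «derives its regularity and decay from that of C^{(j)}_{loc} and H_{k,loc}» -/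

/-- **Composition of exponentially decaying kernels** (`K` on `α × β`, `M` on `β × γ`, the middle carrier finite): with
`|K(a,b)| ≤ Ae^{−δρ₁(a,b)}`, `|M(b,c)| ≤ Be^{−δρ₂(b,c)}`, `ρ₂ ≥ 0`, the triangle inequality `ρ(a,c) ≤ ρ₁(a,b) + ρ₂(b,c)` through every
intermediate point and the row sum `Σ_b e^{−(δ/2)ρ₁(a,b)} ≤ S`: `|Σ_b K(a,b)M(b,c)| ≤ ABS·e^{−(δ/2)ρ(a,c)}` — half of the rate pays the
intermediate sum. [cite: BalabanImbrieJaffe1988, (2.13) p.261] -/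
theorem abs_sum_mul_le_comp [Fintype β] {K : α → β → ℝ} {M : β → γ → ℝ} {ρ₁ : α → β → ℝ} {ρ₂ : β → γ → ℝ}
    {ρ : α → γ → ℝ} {A B δ S : ℝ} (hA : 0 ≤ A) (hB : 0 ≤ B) (hδ : 0 ≤ δ) (hρ₂ : ∀ b c, 0 ≤ ρ₂ b c)
    (htri : ∀ a b c, ρ a c ≤ ρ₁ a b + ρ₂ b c) (hK : ∀ a b, |K a b| ≤ A * Real.exp (-δ * ρ₁ a b))
    (hM : ∀ b c, |M b c| ≤ B * Real.exp (-δ * ρ₂ b c)) (hS : ∀ a, ∑ b, Real.exp (-(δ / 2) * ρ₁ a b) ≤ S) (a : α) (c : γ) :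
    |∑ b, K a b * M b c| ≤ A * B * S * Real.exp (-(δ / 2) * ρ a c) := by
  have hterm : ∀ b, |K a b * M b c| ≤ A * B * Real.exp (-(δ / 2) * ρ a c) * Real.exp (-(δ / 2) * ρ₁ a b) := by
    intro b
    have hexp : Real.exp (-δ * ρ₁ a b) * Real.exp (-δ * ρ₂ b c)
        ≤ Real.exp (-(δ / 2) * ρ a c) * Real.exp (-(δ / 2) * ρ₁ a b) := by
      rw [← Real.exp_add, ← Real.exp_add]
      apply Real.exp_le_exp.2
      have h1 := htri a b c
      have h2 := hρ₂ b c
      nlinarith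
    rw [abs_mul]
    calc |K a b| * |M b c| ≤ A * Real.exp (-δ * ρ₁ a b) * (B * Real.exp (-δ * ρ₂ b c)) :=
          mul_le_mul (hK a b) (hM b c) (abs_nonneg _) (by positivity)
      _ = A * B * (Real.exp (-δ * ρ₁ a b) * Real.exp (-δ * ρ₂ b c)) := by ring
      _ ≤ A * B * (Real.exp (-(δ / 2) * ρ a c) * Real.exp (-(δ / 2) * ρ₁ a b)) :=
          mul_le_mul_of_nonneg_left hexp (mul_nonneg hA hB)
      _ = A * B * Real.exp (-(δ / 2) * ρ a c) * Real.exp (-(δ / 2) * ρ₁ a b) := by ring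
  calc |∑ b, K a b * M b c| ≤ ∑ b, |K a b * M b c| := Finset.abs_sum_le_sum_abs _ _
    _ ≤ ∑ b, A * B * Real.exp (-(δ / 2) * ρ a c) * Real.exp (-(δ / 2) * ρ₁ a b) := Finset.sum_le_sum fun b _ => hterm b
    _ = A * B * Real.exp (-(δ / 2) * ρ a c) * ∑ b, Real.exp (-(δ / 2) * ρ₁ a b) := by rw [Finset.mul_sum]
    _ ≤ A * B * Real.exp (-(δ / 2) * ρ a c) * S := mul_le_mul_of_nonneg_left (hS a) (by positivity)
    _ = A * B * S * Real.exp (-(δ / 2) * ρ a c) := by ring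

/-- **The printed three-factor shape** `G^{(j)}_{loc} = H_{j,loc}C^{(j)}_{loc}H*_{j,loc}` ((2.12); `D_jC^{(j)}H*_j` in (2.22)): factor bounds
`|H| ≤ A₁e^{−δρ₁}`, `|C| ≤ A₂e^{−δρ₂}`, `|H*| ≤ A₃e^{−δρ₃}` (`ρ₂, ρ₃ ≥ 0`), the two triangle inequalities and the row sums
`Σ_b e^{−(δ/2)ρ₁(a,b)} ≤ S₁`, `Σ_c e^{−(δ/4)ρ₁₂(a,c)} ≤ S₂` give `|Σ_c (Σ_b H(a,b)C(b,c)) H*(c,e)| ≤ A₁A₂A₃S₁S₂·e^{−(δ/4)ρ(a,e)}` — *"This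
propagator derives its regularity and decay from that of C^{(j)}_{loc} and H_{k,loc}"*. [cite: BalabanImbrieJaffe1988, (2.12) p.261] -/
theorem abs_sum_mul_le_comp₃ [Fintype β] [Fintype γ] {δ' : Type*} {H : α → β → ℝ} {C : β → γ → ℝ} {Hs : γ → δ' → ℝ}
    {ρ₁ : α → β → ℝ} {ρ₂ : β → γ → ℝ} {ρ₃ : γ → δ' → ℝ} {ρ₁₂ : α → γ → ℝ} {ρ : α → δ' → ℝ} {A₁ A₂ A₃ δ S₁ S₂ : ℝ}
    (hA₁ : 0 ≤ A₁) (hA₂ : 0 ≤ A₂) (hA₃ : 0 ≤ A₃) (hδ : 0 ≤ δ) (hρ₂ : ∀ b c, 0 ≤ ρ₂ b c) (hρ₃ : ∀ c e, 0 ≤ ρ₃ c e)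
    (htri₁₂ : ∀ a b c, ρ₁₂ a c ≤ ρ₁ a b + ρ₂ b c) (htri : ∀ a c e, ρ a e ≤ ρ₁₂ a c + ρ₃ c e)
    (hH : ∀ a b, |H a b| ≤ A₁ * Real.exp (-δ * ρ₁ a b)) (hC : ∀ b c, |C b c| ≤ A₂ * Real.exp (-δ * ρ₂ b c))
    (hHs : ∀ c e, |Hs c e| ≤ A₃ * Real.exp (-δ * ρ₃ c e)) (hS₁ : ∀ a, ∑ b, Real.exp (-(δ / 2) * ρ₁ a b) ≤ S₁)
    (hS₂ : ∀ a, ∑ c, Real.exp (-(δ / 4) * ρ₁₂ a c) ≤ S₂) (a : α) (e : δ') :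
    |∑ c, (∑ b, H a b * C b c) * Hs c e| ≤ A₁ * A₂ * S₁ * A₃ * S₂ * Real.exp (-(δ / 4) * ρ a e) := by
  -- first composition: rate δ ⟶ δ/2 on ρ₁₂
  have hHC : ∀ a c, |∑ b, H a b * C b c| ≤ A₁ * A₂ * S₁ * Real.exp (-(δ / 2) * ρ₁₂ a c) :=
    abs_sum_mul_le_comp hA₁ hA₂ hδ hρ₂ htri₁₂ hH hC hS₁
  -- the third factor at the weaker rate δ/2 (ρ₃ ≥ 0)
  have hHs' : ∀ c e, |Hs c e| ≤ A₃ * Real.exp (-(δ / 2) * ρ₃ c e) := by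
    intro c e
    refine (hHs c e).trans (mul_le_mul_of_nonneg_left (Real.exp_le_exp.2 ?_) hA₃)
    have := hρ₃ c e
    nlinarith
  have hS₁0 : 0 ≤ S₁ := le_trans (Finset.sum_nonneg fun b _ => (Real.exp_pos _).le) (hS₁ a)
  have hδ2 : 0 ≤ δ / 2 := by linarith
  have h44 : δ / 2 / 2 = δ / 4 := by ring
  have hS₂' : ∀ a, ∑ c, Real.exp (-(δ / 2 / 2) * ρ₁₂ a c) ≤ S₂ := by rw [h44]; exact hS₂
  -- second composition: rate δ/2 ⟶ δ/4 on ρ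
  have h := abs_sum_mul_le_comp (K := fun a c => ∑ b, H a b * C b c) (M := Hs) (ρ₁ := ρ₁₂) (ρ₂ := ρ₃) (ρ := ρ)
    (mul_nonneg (mul_nonneg hA₁ hA₂) hS₁0) hA₃ hδ2 hρ₃ htri hHC hHs' hS₂' a e
  rwa [h44] at h

/-- **Finite ranges add under composition**: `K(a,b) = 0` for `ρ₁(a,b) ≥ R₁` and `M(b,c) = 0` for `ρ₂(b,c) ≥ R₂` give, through the triangle
inequality, `Σ_b K(a,b)M(b,c) = 0` for `ρ(a,c) ≥ R₁ + R₂` (r18's `Vanishes`). [cite: BalabanImbrieJaffe1988, (2.13) p.261] -/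
theorem vanishes_comp [Fintype β] {K : α → β → ℝ} {M : β → γ → ℝ} {ρ₁ : α → β → ℝ} {ρ₂ : β → γ → ℝ} {ρ : α → γ → ℝ}
    {R₁ R₂ : ℝ} (htri : ∀ a b c, ρ a c ≤ ρ₁ a b + ρ₂ b c) (hK : Vanishes ρ₁ K R₁) (hM : Vanishes ρ₂ M R₂) :
    Vanishes ρ (fun a c => ∑ b, K a b * M b c) (R₁ + R₂) := by
  intro a c hac
  refine Finset.sum_eq_zero fun b _ => ?_
  by_cases hb : R₁ ≤ ρ₁ a b
  · rw [hK a b hb, zero_mul]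
  · have : R₂ ≤ ρ₂ b c := by have := htri a b c; linarith
    rw [hM b c this, mul_zero]

/-- Three factors: the printed shape `G^{(j)}_{loc} = H_{j,loc}C^{(j)}_{loc}H*_{j,loc}` — ranges `R_H + R_C + R_{H*}`.
[cite: BalabanImbrieJaffe1988, (2.12) p.261] -/
theorem vanishes_comp₃ [Fintype β] [Fintype γ] {δ' : Type*} {H : α → β → ℝ} {C : β → γ → ℝ} {Hs : γ → δ' → ℝ}
    {ρ₁ : α → β → ℝ} {ρ₂ : β → γ → ℝ} {ρ₃ : γ → δ' → ℝ} {ρ₁₂ : α → γ → ℝ} {ρ : α → δ' → ℝ} {R₁ R₂ R₃ : ℝ}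
    (htri₁₂ : ∀ a b c, ρ₁₂ a c ≤ ρ₁ a b + ρ₂ b c) (htri : ∀ a c e, ρ a e ≤ ρ₁₂ a c + ρ₃ c e)
    (hH : Vanishes ρ₁ H R₁) (hC : Vanishes ρ₂ C R₂) (hHs : Vanishes ρ₃ Hs R₃) :
    Vanishes ρ (fun a e => ∑ c, (∑ b, H a b * C b c) * Hs c e) (R₁ + R₂ + R₃) :=
  vanishes_comp htri (vanishes_comp htri₁₂ hH hC) hHs

/-- Finite sums keep a common range (the sum over j in (2.12)). [cite: BalabanImbrieJaffe1988, (2.12) p.261] -/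
theorem vanishes_sum {ι : Type*} (s : Finset ι) {dist : α → β → ℝ} {T : ι → α → β → ℝ} {R : ℝ}
    (hT : ∀ i ∈ s, Vanishes dist (T i) R) : Vanishes dist (fun a b => ∑ i ∈ s, T i a b) R := by
  intro a b hab
  exact Finset.sum_eq_zero fun i hi => hT i hi a b hab

/-! ## §3  (2.23): the uniform bound away from the diagonal -/

/-- **Per-scale kernel bounds ⟹ the uniform bound (two explicit constants).**  A family of kernels `T_n` on a common carrier (the terms of
(2.22) rescaled to step k, `n = k − j`; `n = 0` = `D_k`) with `|T_n(x,b′)| ≤ AΛⁿe^{−δLⁿ dist(x,b′)}` («exponential decay on their respective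
length scales» with «scalings» `Λⁿ`) sums to a kernel bounded by `(A/(1−q))·e^{−δ dist(x,b′)}` for `dist(x,b′) ≥ d₀`, whatever the number `N`
of scales, once `Λe^{−δ(L−1)d₀} ≤ q < 1`. [cite: BalabanImbrieJaffe1988, (2.23) p.262] -/
theorem abs_multiscaleKernel_le {dist : α → β → ℝ} {T : ℕ → α → β → ℝ} {L Λ δ A d₀ q : ℝ} (hL : 1 ≤ L) (hΛ : 0 ≤ Λ)
    (hδ : 0 ≤ δ) (hA : 0 ≤ A) (hd₀ : 0 ≤ d₀) (hq : Λ * Real.exp (-(δ * (L - 1) * d₀)) ≤ q) (hq1 : q < 1)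
    (hT : ∀ n x b, |T n x b| ≤ A * Λ ^ n * Real.exp (-(δ * L ^ n) * dist x b)) (N : ℕ) (x : α) (b : β)
    (hxb : d₀ ≤ dist x b) : |∑ n ∈ range N, T n x b| ≤ A / (1 - q) * Real.exp (-δ * dist x b) := by
  have hsum := multiscale_sum_le hL hΛ hδ hd₀ hq hq1 N hxb
  calc |∑ n ∈ range N, T n x b| ≤ ∑ n ∈ range N, |T n x b| := Finset.abs_sum_le_sum_abs _ _
    _ ≤ ∑ n ∈ range N, A * (Λ ^ n * Real.exp (-(δ * L ^ n) * dist x b)) :=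
        Finset.sum_le_sum fun n _ => by rw [← mul_assoc]; exact hT n x b
    _ = A * ∑ n ∈ range N, Λ ^ n * Real.exp (-(δ * L ^ n) * dist x b) := by rw [Finset.mul_sum]
    _ ≤ A * (Real.exp (-δ * dist x b) / (1 - q)) := mul_le_mul_of_nonneg_left hsum hA
    _ = A / (1 - q) * Real.exp (-δ * dist x b) := by ring

/-- **(2.23), THE TYPED ROW** `BIJ88Sect2Statements.DecayFar dist C_k c` for the (2.22)-shaped sum `C_k = Σ_{n<N}T_n`, in print's one-letter
shape (threshold = prefactor = rate = c), for any `c` with `Λe^{−δ(L−1)c} ≤ ½` (c beyond the threshold of `half_of_threshold`),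
`2A ≤ c ≤ δ`. [cite: BalabanImbrieJaffe1988, (2.23) p.262] -/
theorem decayFar223_typed {dist : α → β → ℝ} {T : ℕ → α → β → ℝ} {L Λ δ A c : ℝ} (hL : 1 ≤ L) (hΛ : 0 ≤ Λ)
    (hA : 0 ≤ A) (hc : 0 ≤ c) (hhalf : Λ * Real.exp (-(δ * (L - 1) * c)) ≤ 1 / 2) (hlow : 2 * A ≤ c) (hhigh : c ≤ δ)
    (hT : ∀ n x b, |T n x b| ≤ A * Λ ^ n * Real.exp (-(δ * L ^ n) * dist x b)) (N : ℕ) :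
    DecayFar dist (fun x b => ∑ n ∈ range N, T n x b) c := by
  intro x b hxb
  have hδ : 0 ≤ δ := hc.trans hhigh
  have h := abs_multiscaleKernel_le hL hΛ hδ hA hc hhalf (by norm_num) hT N x b hxb
  rw [show A / (1 - 1 / 2) = 2 * A by ring] at h
  refine h.trans ?_
  have hd : 0 ≤ dist x b := hc.trans hxb
  calc 2 * A * Real.exp (-δ * dist x b) ≤ c * Real.exp (-δ * dist x b) :=
        mul_le_mul_of_nonneg_right hlow (Real.exp_pos _).le
    _ ≤ c * Real.exp (-c * dist x b) := by
        refine mul_le_mul_of_nonneg_left (Real.exp_le_exp.2 ?_) hc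
        nlinarith

open BIJ85Sect7Statements in
/-- **(2.23) with «for D_k the required estimate is (I.7.2.4)» discharged to r15's typed [I] (7.2.4)**: on the carrier of
`BIJ85Sect7Statements.KernelData` (x ∈ T_η, b ∈ T₁^{(k)*}, `dist(x,b)`), the kernel `D_k = K.D` with `K.Ineq724 M δ` is the `n = 0` term; the
`j < k` terms of (2.22), rescaled to step k, enter with their per-scale bounds at the same constants; then `C_k = D_k + Σ_{1≤n≤k}T_n` obeys the
typed row `DecayFar K.distEB C_k c` under `Λe^{−δ(L−1)c} ≤ ½`, `2M ≤ c ≤ δ`. [cite: BalabanImbrieJaffe1988, (2.23) p.262] -/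
theorem decayFar223_of_ineq724 (K : KernelData) {M δ : ℝ} (h724 : K.Ineq724 M δ) {T : ℕ → K.SiteEta → K.BondU → ℝ}
    {L Λ c : ℝ} (hL : 1 ≤ L) (hΛ : 0 ≤ Λ) (hM : 0 ≤ M) (hc : 0 ≤ c) (hhalf : Λ * Real.exp (-(δ * (L - 1) * c)) ≤ 1 / 2)
    (hlow : 2 * M ≤ c) (hhigh : c ≤ δ)
    (hT : ∀ n x b, 1 ≤ n → |T n x b| ≤ M * Λ ^ n * Real.exp (-(δ * L ^ n) * K.distEB x b)) (k : ℕ) :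
    DecayFar K.distEB (fun x b => K.D x b + ∑ n ∈ Ico 1 (k + 1), T n x b) c := by
  classical
  -- the family with D_k in slot n = 0 and the j = k − n terms in slots 1 ≤ n ≤ k
  set T' : ℕ → K.SiteEta → K.BondU → ℝ := fun n => if n = 0 then K.D else T n with hT'
  have hT'b : ∀ n x b, |T' n x b| ≤ M * Λ ^ n * Real.exp (-(δ * L ^ n) * K.distEB x b) := by
    intro n x b
    by_cases hn : n = 0
    · subst hn
      simp only [hT', if_true, pow_zero, mul_one]
      have := h724 x b
      rwa [neg_mul]
    · simp only [hT', hn, if_false]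
      exact hT n x b (Nat.one_le_iff_ne_zero.2 hn)
  have hdec := decayFar223_typed hL hΛ hM hc hhalf hlow hhigh hT'b (k + 1)
  intro x b hxb
  have h0 : T' 0 x b = K.D x b := by simp [hT']
  have hrest : ∑ n ∈ Ico 1 (k + 1), T' n x b = ∑ n ∈ Ico 1 (k + 1), T n x b := by
    refine Finset.sum_congr rfl fun n hn => ?_
    have hn1 : n ≠ 0 := by
      have := (Finset.mem_Ico.1 hn).1; omega
    simp [hT', hn1]
  have hsplit : ∑ n ∈ range (k + 1), T' n x b = K.D x b + ∑ n ∈ Ico 1 (k + 1), T n x b := by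
    rw [Finset.range_eq_Ico, Finset.sum_eq_sum_Ico_succ_bot (Nat.succ_pos k), h0, hrest]
  simpa [hsplit] using hdec x b hxb

/-! ## §4  (2.16): «[The rapid decay of the terms with small j compensates for the scaling factors (L^jη)^{−1}.]» -/

/-- **(2.16), the bracketed mechanism**: if the kernel of `σ_k` splits as a near-diagonal part `Dg` vanishing beyond the threshold `c`
(print: the part «of the order of η^{−2}» for close plaquettes) plus the hierarchical terms `T_n`, `n < N`, with per-scale bounds
`|T_n(p₁,p₂)| ≤ ALⁿe^{−δLⁿdist(p₁,p₂)}` (scaling factors `(L^jη)^{−1} = Lⁿ`), then `DecayFar dist σ_k c` for any `c` with `Le^{−δ(L−1)c} ≤ ½`,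
`2A ≤ c ≤ δ` — uniformly in k. [cite: BalabanImbrieJaffe1988, (2.16) p.261] -/
theorem decayFar216_typed {dist : α → α → ℝ} {σ Dg : α → α → ℝ} {T : ℕ → α → α → ℝ} {L δ A c : ℝ} {N : ℕ} (hL : 1 ≤ L)
    (hA : 0 ≤ A) (hc : 0 ≤ c) (hhalf : L * Real.exp (-(δ * (L - 1) * c)) ≤ 1 / 2) (hlow : 2 * A ≤ c) (hhigh : c ≤ δ)
    (hσ : ∀ p₁ p₂, σ p₁ p₂ = Dg p₁ p₂ + ∑ n ∈ range N, T n p₁ p₂) (hDg : Vanishes dist Dg c)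
    (hT : ∀ n p₁ p₂, |T n p₁ p₂| ≤ A * L ^ n * Real.exp (-(δ * L ^ n) * dist p₁ p₂)) : DecayFar dist σ c := by
  have hdec := decayFar223_typed hL (zero_le_one.trans hL) hA hc hhalf hlow hhigh hT N
  intro p₁ p₂ hp
  rw [hσ, hDg p₁ p₂ hp, zero_add]
  exact hdec p₁ p₂ hp

/-! ## §5  (2.13): the operator bound for all points, and the finite range -/

/-- **(2.13), two explicit constants.**  The kernel of `𝒟_{k,loc}` (output bond b, input bond a) as the sum of its hierarchical terms `T_n`
with per-scale bounds `|T_n(b,a)| ≤ AΛⁿe^{−δLⁿdist(a,b)}` and scaling factors `Λ < 1` (no threshold), plus the row sums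
`Σ_a e^{−(δ/2)dist(a,b)} ≤ S`: `|(𝒟_{k,loc}f)(b)| ≤ (A/(1−Λ))S·e^{−(δ/2)dist(suppt f,b)}‖f‖_∞` for EVERY b, uniformly in the number of scales —
by §1 and p02's kernel ⟹ operator step `BIJ88OpDecay230Proof.abs_applyK_le_of_kernel`. [cite: BalabanImbrieJaffe1988, (2.13) p.261] -/
theorem opDecay213 [Fintype α] {dist : α → β → ℝ} {T : ℕ → β → α → ℝ} {L Λ δ A S : ℝ} (hL : 1 ≤ L) (hΛ : 0 ≤ Λ)
    (hΛ1 : Λ < 1) (hδ : 0 ≤ δ) (hA : 0 ≤ A) (hd : ∀ a b, 0 ≤ dist a b)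
    (hT : ∀ n b a, |T n b a| ≤ A * Λ ^ n * Real.exp (-(δ * L ^ n) * dist a b))
    (hS : ∀ b, ∑ a, Real.exp (-(δ / 2) * dist a b) ≤ S) (N : ℕ) (f : α → ℝ) (b : β) :
    |applyK (fun b a => ∑ n ∈ range N, T n b a) f b|
      ≤ A / (1 - Λ) * S * Real.exp (-(δ / 2) * suppDist dist f b) * supNorm f := by
  have hA' : 0 ≤ A / (1 - Λ) := div_nonneg hA (by linarith)
  have hK : ∀ a, |∑ n ∈ range N, T n b a| ≤ A / (1 - Λ) * Real.exp (-δ * dist a b) := by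
    intro a
    refine abs_multiscaleKernel_le (dist := fun b a => dist a b) (T := T) hL hΛ hδ hA le_rfl ?_ hΛ1
      (fun n x y => hT n x y) N b a (hd a b)
    simp
  exact abs_applyK_le_of_kernel hA' hδ hK (hS b) f

/-- **(2.13), THE TYPED ROW** `BIJ88Sect2Statements.OpDecay dist 𝒟_{k,loc} c` in print's one-letter shape, for any `c` with
`(A/(1−Λ))S ≤ c ≤ δ/2`. [cite: BalabanImbrieJaffe1988, (2.13) p.261] -/
theorem opDecay213_typed [Fintype α] {dist : α → β → ℝ} {T : ℕ → β → α → ℝ} {L Λ δ A S c : ℝ} (hL : 1 ≤ L) (hΛ : 0 ≤ Λ)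
    (hΛ1 : Λ < 1) (hδ : 0 ≤ δ) (hA : 0 ≤ A) (hd : ∀ a b, 0 ≤ dist a b)
    (hT : ∀ n b a, |T n b a| ≤ A * Λ ^ n * Real.exp (-(δ * L ^ n) * dist a b))
    (hS : ∀ b, ∑ a, Real.exp (-(δ / 2) * dist a b) ≤ S) (hlow : A / (1 - Λ) * S ≤ c) (hhigh : c ≤ δ / 2) (N : ℕ) :
    OpDecay dist (fun b a => ∑ n ∈ range N, T n b a) c := by
  intro f b
  have h := opDecay213 hL hΛ hΛ1 hδ hA hd hT hS N f b
  refine h.trans ?_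
  have hsN : 0 ≤ supNorm f := supNorm_nonneg f
  have hsD : 0 ≤ suppDist dist f b := suppDist_nonneg hd f b
  have hS0 : 0 ≤ S := le_trans (Finset.sum_nonneg fun a _ => (Real.exp_pos _).le) (hS b)
  have hAS : 0 ≤ A / (1 - Λ) * S := mul_nonneg (div_nonneg hA (by linarith)) hS0
  have hc : 0 ≤ c := hAS.trans hlow
  calc A / (1 - Λ) * S * Real.exp (-(δ / 2) * suppDist dist f b) * supNorm f
      ≤ c * Real.exp (-(δ / 2) * suppDist dist f b) * supNorm f := by gcongr
    _ ≤ c * Real.exp (-c * suppDist dist f b) * supNorm f := by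
        refine mul_le_mul_of_nonneg_right (mul_le_mul_of_nonneg_left (Real.exp_le_exp.2 ?_) hc) hsN
        nlinarith

/-- **The finite range of one term of (2.12)**, `G^{(k)}_{loc} = H_{k,loc}C^{(k)}_{loc}H*_{k,loc}`: with `H_{k,loc}(b,b′) = 0` for
`dist ≧ ⅛r(e_k)` ((2.1), (2.6)), `C^{(k)}_{loc}(b′₁,b′₂) = 0` for `dist ≧ ¼r(e_k)` (the truncation radius of (2.8)) and the same for the adjoint
factor, the composite vanishes for `dist(b₁,b₂) ≧ ⅛r + ¼r + ⅛r = ½r(e_k)`. [cite: BalabanImbrieJaffe1988, (2.13) p.261] -/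
theorem vanishes213_term [Fintype β] [Fintype γ] {δ' : Type*} {H : α → β → ℝ} {C : β → γ → ℝ} {Hs : γ → δ' → ℝ}
    {ρ₁ : α → β → ℝ} {ρ₂ : β → γ → ℝ} {ρ₃ : γ → δ' → ℝ} {ρ₁₂ : α → γ → ℝ} {ρ : α → δ' → ℝ} {rek : ℝ}
    (htri₁₂ : ∀ a b c, ρ₁₂ a c ≤ ρ₁ a b + ρ₂ b c) (htri : ∀ a c e, ρ a e ≤ ρ₁₂ a c + ρ₃ c e)
    (hH : Vanishes ρ₁ H (rek / 8)) (hC : Vanishes ρ₂ C (rek / 4)) (hHs : Vanishes ρ₃ Hs (rek / 8)) :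
    Vanishes ρ (fun a e => ∑ c, (∑ b, H a b * C b c) * Hs c e) (rek / 2) := by
  have h := vanishes_comp₃ htri₁₂ htri hH hC hHs
  have : rek / 8 + rek / 4 + rek / 8 = rek / 2 := by ring
  rwa [this] at h

/-- **«Furthermore, 𝒟_{k,loc}(b₁,b₂) = 0 for dist(b₁,b₂) ≧ ½r(e_k)», THE TYPED ROW** `BIJ88Sect2Statements.Vanishes dist 𝒟_{k,loc} (r(e_k)/2)`:
every hierarchical term, rescaled to step k, has range at most `½r(e_k)` (for the top term by `vanishes213_term`; for `j < k` the displayed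
hypothesis, print's implicit `L^{j−k}·½r(e_j) ≤ ½r(e_k)`), hence so has the sum. [cite: BalabanImbrieJaffe1988, (2.13) p.261] -/
theorem vanishes213_typed {dist : α → β → ℝ} {T : ℕ → α → β → ℝ} {rek : ℝ} (N : ℕ)
    (hT : ∀ n < N, Vanishes dist (T n) (rek / 2)) :
    Vanishes dist (fun b₁ b₂ => ∑ n ∈ range N, T n b₁ b₂) (rek / 2) :=
  vanishes_sum (range N) fun n hn => hT n (Finset.mem_range.1 hn)

end

end Literature.MathematicalPhysics.QuantumFieldTheory.BalabanImbrieJaffe1984to88.BIJ88MultiscaleDecay223
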